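import Summits.QuantumFields.BalabanUV.Beta.FP.TorusCompositeInsertionKernel
import Summits.QuantumFields.BalabanUV.Beta.FP.TorusCompositeInsertionPeriodicTwo

/-!
# `BalabanUV.Beta.FP.TorusCompositeInsertionKernelTwo` — road «FP» for binder row D1, ROUTE T: **THE KERNEL-LEVEL (S3-2) FORM OF THE ORDER-2 COMPOSITE
# JUNCTION** — the entries of OUR composite second-order insertion bi-jet `compIns₂₂ … n h h′` as the `h ⊗ h′`-weighted sum over ALL PAIRS OF COPIES of a
# two-bond lattice family `𝒲` whose border entries are a kernel of the bi-functional `𝓘₂` (R-9 `TorusCompositeInsertionKernel` one order up; the shape #41d ∕ #42a's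
# `hQF₂ ∕ hQN₂ : ½ • (Q₁₂f (dv a₁) (dv a₂) + Q₁₂f (dv a₂) (dv a₁)) = (perF T (dper T (𝒲 μ 0 ν z))).submatrix fF ff` read), WITH THE WRAP-AROUND LETTER LOCATED

WHY.  R-8 `TorusCompositeInsertionPeriodicTwo` identifies the ACTION of `compIns₂₂ … n h h′` on finest-periodic forms with any bi-functional `𝓘₂` obeying OUR second
chain rule (clauses `h0₁ hsucc₁ h0₂ hsucc₂`).  §1 reads off the ENTRIES at the periodic indicator of a torus bond (`compIns₂₂_apply_eq`, R-7 §4's twin).  For a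
two-bond family `𝒲 κ u κ′ u′ : MKer` (indexed by the two background LATTICE bonds), windowed in the fluctuation slot and in both family bonds (`hS hT hT′`) and whose
`(inr κ₀, inl l)` entries at the coarse multiplier sites `Lc^n • x̄` are a kernel of `𝓘₂ lev rs n` (`h𝒲`), §4 gives the EXACT identity for all torus weights `h, h′`:
  `Σ_{b,b′} h b · h′ b′ · Σ'_{m₁} Σ'_{m₂} Σ'_m 𝒲 b.2 (b.1 + T∘m₁) b′.2 (b′.1 + T∘m₂) (Lc^n • x̄) (z + T∘m) (inr κ₀) (inl β) = compIns₂₂ Lc M lev rs n h h′ (x̄, κ₀) (z, β)`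
— ALL pairs of copies `(m₁, m₂)` of the two torus bonds load (`T = towerTorus Lc M n`).  The (S3-2) socket binds instead the DIAGONAL periodisation
`perZ T (dper T (𝒲 κ u κ′ u′))`, which under joint block covariance (`hWt`) is the sum over the SIMULTANEOUS copies `m₁ = m₂` only (g16 `PeriodisedBorderTables`
§7 `dper_apply_of_blockCov₂` and its LOCATED REMARK on the second jets).  §5 states the junction AT ONE LATTICE-LABELLED BOND PAIR `(κ, u), (κ′, u′)` under the
SEPARATION LETTER `hsep` («no window of the multiplier site holds a copy of `u` and a copy of `u′` with different period vectors»):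
  `perZ T (dper T (𝒲 κ u κ′ u′)) (Lc^n • x̄) z (inr κ₀) (inl β) = compIns₂₂ Lc M lev rs n δ_{(wrapPt T u, κ)} δ_{(wrapPt T u′, κ′)} (x̄, κ₀) (z, β)`
(+ the symmetrised form `½ • (… + …)` by `compIns₂₂_comm`), and `sep_of_window_lt` discharges `hsep` from «window extent + bond separation < period» — so the
order-2 namings hold box by box for every box whose period exceeds the window diameter plus `|u − u′|`, i.e. for all boxes of a growing sequence beyond some
`K₀(u, u′)` (instantiate the per-box law on the tail sequence), and NOT for small boxes (the wrap-around pairs are real there).  §2 is R-9 at one lattice-labelled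
bond (order 1 holds at EVERY box: `dper_translate_bond`).  §3 is the two-variable lift engine.  No lattice object is DEFINED; `𝒲` and `𝓘₂` are the row's (F5).

[folklore] finite sums + finitely supported `tsum` re-indexing BY NAME (R-9 `tsum_mul_indicator_wrap ∕ sum_mul_perZ_dper_eq_compIns₁_apply`, R-6's lift engine
`sum_mul_tsum_translate_eq_tsum_lift`, g16 `dper_apply_of_blockCov₂ ∕ dper_translate_bond`, R-8 `sum_compIns₂₂_mul_periodic'`, Mathlib `Summable.tsum_comm`);
no `def`, no `def … : Prop`, nothing cited, 0 sorry; NO chart; nothing of Bałaban's asserted.  NOT HERE: the row's `𝒲` (the chart's symmetrised second dressed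
vertex through the composite corrector, S-an2-g49-1 §2) and the proof that its border entries are a kernel of the row's `𝓘₂` — that identity IS the (C1) TABLE word
at order 2 (R-D1-g42-4); the field–field blocks (H-jets); estimates.

HONEST DEPENDENCY (page 1, mandatory): continuum YM on T⁴ ⇐ BetaPertH ∧ nine spine estimates (0/9 proved); BetaPertH ⇐ (D1) ∧ (D4) ∧ CAP+tail;
G-an2-4 gates asym, D1 and NE2/3/4.  HONEST FRAMING (cell contract, verbatim): «discharging `BetaPertH` makes Bałaban's UV stability UNCONDITIONAL —
a real constructive-QFT result; it is NOT the continuum limit and NOT the Clay problem.»  ABSOLUTE RULE (cell charter, verbatim): «No internally-minted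
statement may enter as a cited fact. Every hypothesis is either kernel-proved in this package or a verbatim quotation of a PUBLISHED theorem with page
reference. The manuscript(s) under audit are NOT citable for their own disputed steps — they are the thing under adjudication; programme-internal
(2001/route/tribunal) claims are never citable.»  0 estimates; 0∕4 row-D1 binders (hW, hR, D1Tel, D1Rep); NOT (T-ID), NOT (C1), NOT SDF, NOT D1,
NOT BetaPertH, NOT continuum, NOT Clay.  D1 formalisation swarm LEAF PROVER 02 (b2b-balaban-beta-d1-formalise-leaf-02 gen 29), 2026-08-23.  No existing file touched.
-/

noncomputable section

open scoped BigOperators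

namespace Summit.QuantumFields.BalabanUV.Beta.FP.TorusCompositeInsertionKernelTwo

open Matrix Finset
open Literature.MathematicalPhysics.QuantumFieldTheory
open Literature.MathematicalPhysics.QuantumFieldTheory.Balaban1983to89
open Literature.MathematicalPhysics.QuantumFieldTheory.Balaban1983to89.Beta
open B5Prop11Plancherel (fine)
open B6Lemma24Torus (pbox mem_pbox wrap)
open B4TorusKernel.MultiPeriod (translate translate_apply)
open B4Reflection242 (translate_translate)
open ExpKernelCalculus (MKer shiftK)
open AffineAveraging (Site Form1 box toSite)
open AveragingContoursRooted (linAvgAt)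
open AveragingHessianKernelsRooted (vhKerAt)
open AveragingMixedJetTables (vh2KerAt)
open OneStepResolventKernel (Fib)
open Summit.QuantumFields.BalabanUV.Beta.BorderedHessian (stepScale)
open Summit.QuantumFields.BalabanUV.Beta.GAN24.KernelPeriodisation (wrap_translate quo translate_wrap_quo)
open Summit.QuantumFields.BalabanUV.Beta.FP.KernelPeriodisationFib (perZ perZ_apply)
open Summit.QuantumFields.BalabanUV.Beta.FP.KernelPeriodisationFibLoc (dper)
open Summit.QuantumFields.BalabanUV.Beta.FP.PeriodisedBorderTables (dper_apply_of_blockCov₂ dper_translate_bond)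
open Summit.QuantumFields.BalabanUV.Beta.FP.TorusGaugeCovariancePairing (wrapPt wrapPt_coe wrapPt_of_mem)
open Summit.QuantumFields.BalabanUV.Beta.FP.TorusCompositeObjects (towerTorus towerTorus_apply)
open Summit.QuantumFields.BalabanUV.Beta.CompositeAveragingCoarseExact (compLinAvgAt)
open Summit.QuantumFields.BalabanUV.Beta.FP.TorusCompositeCovarianceOne (compIns₁)
open Summit.QuantumFields.BalabanUV.Beta.FP.TorusCompositeCovarianceTwoPolar (compIns₂₂ compIns₂₂_comm)
open Summit.QuantumFields.BalabanUV.Beta.FP.TorusStepInsertionPeriodic (exists_finset_translate)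
open Summit.QuantumFields.BalabanUV.Beta.FP.TorusStepInsertionPeriodicTwo (sum_mul_tsum_translate_eq_tsum_lift)
open Summit.QuantumFields.BalabanUV.Beta.FP.TorusCompositeInsertionPeriodicTwo (sum_compIns₂₂_mul_periodic')
open Summit.QuantumFields.BalabanUV.Beta.FP.TorusCompositeInsertionKernel (tsum_mul_indicator_wrap sum_mul_perZ_dper_eq_compIns₁_apply)

variable {d : ℕ} (Lc : ℕ) [NeZero Lc]

/-! ## §1 The entries of `compIns₂₂ … n h h′`: the bi-functional at (the two lifts, the periodic indicator of a torus bond) -/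

/-- [folklore] **THE ENTRIES OF THE COMPOSITE SECOND-ORDER INSERTION BI-JET** (R-7 §4 `compIns₁_apply_eq` one order up): for any `𝓘₁, 𝓘₂` with the clauses
`h0₁ hsucc₁ h0₂ hsucc₂` (R-8), `compIns₂₂ Lc M lev rs n h h′ (x, κ₀) (z, β) = 𝓘₂ lev rs n (lift h) (lift h′) ((l, w) ↦ δ_{(β,z)} (l, wrap T w)) κ₀ x`,
`T = towerTorus Lc M n` — the matrix-level reading the (S3-2) naming `hQF₂` consumes. -/
theorem compIns₂₂_apply_eq
    (𝓘₁ : (ℕ → ℕ) → (ℕ → (Fin (d + 1) → ℕ)) → ℕ → Form1 (d + 1) ℝ → Form1 (d + 1) ℝ → Form1 (d + 1) ℝ)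
    (h0₁ : ∀ (lev : ℕ → ℕ) (rs : ℕ → (Fin (d + 1) → ℕ)) (H B : Form1 (d + 1) ℝ), 𝓘₁ lev rs 0 H B = 0)
    (hsucc₁ : ∀ (lev : ℕ → ℕ) (rs : ℕ → (Fin (d + 1) → ℕ)) (n : ℕ) (H B : Form1 (d + 1) ℝ) (κ : Fin (d + 1)) (x : Site (d + 1)),
      𝓘₁ lev rs (n + 1) H B κ x
        = (((Lc : ℝ) ^ (d + 1) * stepScale d Lc (lev 1)) * (∏ i ∈ Finset.range n, (stepScale d Lc (lev (i + 1 + 1)) * ((box (d + 1) Lc).card : ℝ)))⁻¹) *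
            (∑' u : Site (d + 1), ∑ κ' : Fin (d + 1),
              (∑' z : Site (d + 1), ∑ l : Fin (d + 1), vhKerAt (toSite (rs 1)) Lc κ x (l, z) (κ', u) *
                ((∏ i ∈ Finset.range n, stepScale d Lc (lev (i + 1 + 1))) * compLinAvgAt (fun i => rs (n - i + 1)) Lc n B l z)) *
              ((∏ i ∈ Finset.range n, stepScale d Lc (lev (i + 1 + 1))) * compLinAvgAt (fun i => rs (n - i + 1)) Lc n H κ' u))
          + stepScale d Lc (lev 1) * linAvgAt (toSite (rs 1)) (𝓘₁ (fun k => lev (k + 1)) (fun k => rs (k + 1)) n H B) Lc κ x)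
    (𝓘₂ : (ℕ → ℕ) → (ℕ → (Fin (d + 1) → ℕ)) → ℕ → Form1 (d + 1) ℝ → Form1 (d + 1) ℝ → Form1 (d + 1) ℝ → Form1 (d + 1) ℝ)
    (h0₂ : ∀ (lev : ℕ → ℕ) (rs : ℕ → (Fin (d + 1) → ℕ)) (H H' B : Form1 (d + 1) ℝ), 𝓘₂ lev rs 0 H H' B = 0)
    (hsucc₂ : ∀ (lev : ℕ → ℕ) (rs : ℕ → (Fin (d + 1) → ℕ)) (n : ℕ) (H H' B : Form1 (d + 1) ℝ) (κ₀ : Fin (d + 1)) (x : Site (d + 1)),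
      𝓘₂ lev rs (n + 1) H H' B κ₀ x
        = ((((Lc : ℝ) ^ (d + 1) * stepScale d Lc (lev 1)) * (∏ i ∈ Finset.range n, (stepScale d Lc (lev (i + 1 + 1)) * ((box (d + 1) Lc).card : ℝ)))⁻¹) * (∏ i ∈ Finset.range n, (stepScale d Lc (lev (i + 1 + 1)) * ((box (d + 1) Lc).card : ℝ)))⁻¹) *
            (∑' u : Site (d + 1), ∑ κ : Fin (d + 1), (∑' u' : Site (d + 1), ∑ κ' : Fin (d + 1),
              (∑' z : Site (d + 1), ∑ l : Fin (d + 1),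
                (1 / 2 : ℝ) * (vh2KerAt (toSite (rs 1)) Lc κ₀ x (l, z) (κ, u) (κ', u') + vh2KerAt (toSite (rs 1)) Lc κ₀ x (l, z) (κ', u') (κ, u)) *
                  ((∏ i ∈ Finset.range n, stepScale d Lc (lev (i + 1 + 1))) * compLinAvgAt (fun i => rs (n - i + 1)) Lc n B l z)) *
              ((∏ i ∈ Finset.range n, stepScale d Lc (lev (i + 1 + 1))) * compLinAvgAt (fun i => rs (n - i + 1)) Lc n H' κ' u')) *
              ((∏ i ∈ Finset.range n, stepScale d Lc (lev (i + 1 + 1))) * compLinAvgAt (fun i => rs (n - i + 1)) Lc n H κ u))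
          + (((Lc : ℝ) ^ (d + 1) * stepScale d Lc (lev 1)) * (∏ i ∈ Finset.range n, (stepScale d Lc (lev (i + 1 + 1)) * ((box (d + 1) Lc).card : ℝ)))⁻¹) *
            ((∑' u : Site (d + 1), ∑ κ' : Fin (d + 1),
              (∑' z : Site (d + 1), ∑ l : Fin (d + 1), vhKerAt (toSite (rs 1)) Lc κ₀ x (l, z) (κ', u) * 𝓘₁ (fun k => lev (k + 1)) (fun k => rs (k + 1)) n H' B l z) *
                ((∏ i ∈ Finset.range n, stepScale d Lc (lev (i + 1 + 1))) * compLinAvgAt (fun i => rs (n - i + 1)) Lc n H κ' u))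
            + (∑' u : Site (d + 1), ∑ κ' : Fin (d + 1),
              (∑' z : Site (d + 1), ∑ l : Fin (d + 1), vhKerAt (toSite (rs 1)) Lc κ₀ x (l, z) (κ', u) * 𝓘₁ (fun k => lev (k + 1)) (fun k => rs (k + 1)) n H B l z) *
                ((∏ i ∈ Finset.range n, stepScale d Lc (lev (i + 1 + 1))) * compLinAvgAt (fun i => rs (n - i + 1)) Lc n H' κ' u)))
          + stepScale d Lc (lev 1) * linAvgAt (toSite (rs 1)) (𝓘₂ (fun k => lev (k + 1)) (fun k => rs (k + 1)) n H H' B) Lc κ₀ x)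
    (n : ℕ) (M : Fin (d + 1) → ℕ) [∀ μ, NeZero (M μ)] (lev : ℕ → ℕ) (rs : ℕ → (Fin (d + 1) → ℕ)) (hrs : ∀ k, rs k ∈ box (d + 1) Lc)
    (h h' : ↥(pbox (towerTorus Lc M n)) × Fin (d + 1) → ℝ) (x : ↥(pbox M)) (κ₀ : Fin (d + 1)) (z : ↥(pbox (towerTorus Lc M n))) (β : Fin (d + 1)) :
    compIns₂₂ Lc M lev rs n h h' (x, κ₀) (z, β)
      = 𝓘₂ lev rs n (fun l w => h (wrapPt (towerTorus Lc M n) w, l)) (fun l w => h' (wrapPt (towerTorus Lc M n) w, l))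
          (fun l w => KKTFluctuationKernel.delta1 β (z : Site (d + 1)) l (wrap (towerTorus Lc M n) w)) κ₀ (x : Site (d + 1)) := by
  classical
  have hA : ∀ (l : Fin (d + 1)) (w t : Site (d + 1)),
      (fun l w => KKTFluctuationKernel.delta1 β (z : Site (d + 1)) l (wrap (towerTorus Lc M n) w)) l (translate (towerTorus Lc M n) w t)
        = (fun l w => KKTFluctuationKernel.delta1 β (z : Site (d + 1)) l (wrap (towerTorus Lc M n) w)) l w := fun l w t => by
    show KKTFluctuationKernel.delta1 β _ l (wrap _ (translate _ w t)) = KKTFluctuationKernel.delta1 β _ l (wrap _ w)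
    rw [B6Lemma24Torus.wrap_congr (x' := w)]
    intro i
    rw [translate_apply]
    exact ⟨t i, by ring⟩
  rw [← sum_compIns₂₂_mul_periodic' Lc 𝓘₁ h0₁ hsucc₁ 𝓘₂ h0₂ hsucc₂ n M lev rs hrs h h' _ hA x κ₀]
  have hval : ∀ q : ↥(pbox (towerTorus Lc M n)) × Fin (d + 1),
      (fun l w => KKTFluctuationKernel.delta1 β (z : Site (d + 1)) l (wrap (towerTorus Lc M n) w)) q.2 (q.1 : Site (d + 1))
        = if q = (z, β) then 1 else 0 := fun q => by
    show KKTFluctuationKernel.delta1 β _ q.2 (wrap _ _) = _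
    rw [B6Lemma24Torus.wrap_eq_self q.1.2, KKTFluctuationKernel.delta1_apply]
    obtain ⟨w, l⟩ := q
    by_cases hq : (w, l) = (z, β)
    · rw [if_pos hq, if_pos]
      obtain ⟨h1, h2⟩ := Prod.mk.inj hq
      exact ⟨h2, by rw [h1]⟩
    · rw [if_neg hq, if_neg]
      rintro ⟨h2, h1⟩
      exact hq (Prod.ext (Subtype.ext h1) h2)
  simp only [hval, mul_ite, mul_one, mul_zero, Finset.sum_ite_eq', Finset.mem_univ, if_true]

/-! ## §2 Plumbing: the two-variable lift engine -/

/-- [folklore] **the two-variable lift engine** (R-6 `sum_mul_tsum_translate_eq_tsum_lift` twice): for `G` finitely supported in both lattice bonds,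
`Σ_{b,b′} h b · h′ b′ · Σ'_{m} Σ'_{m′} G b.2 (b.1 + T∘m) b′.2 (b′.1 + T∘m′) = Σ'_u Σ_κ (Σ'_{u′} Σ_{κ′} G κ u κ′ u′ · h′ (wrapPt T u′, κ′)) · h (wrapPt T u, κ)`
(box × period lattice = lattice, in each variable). -/
theorem sum_sum_mul_tsum_translate₂_eq_tsum_lift₂ (T : Fin (d + 1) → ℕ) [∀ μ, NeZero (T μ)]
    (G : Fin (d + 1) → Site (d + 1) → Fin (d + 1) → Site (d + 1) → ℝ) (S : Finset (Site (d + 1)))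
    (hG : ∀ (κ κ' : Fin (d + 1)) (u' : Site (d + 1)), ∀ u ∉ S, G κ u κ' u' = 0)
    (hG' : ∀ (κ : Fin (d + 1)) (u : Site (d + 1)) (κ' : Fin (d + 1)), ∀ u' ∉ S, G κ u κ' u' = 0)
    (h h' : ↥(pbox T) × Fin (d + 1) → ℝ) :
    ∑ b : ↥(pbox T) × Fin (d + 1), ∑ b' : ↥(pbox T) × Fin (d + 1), h b * (h' b' *
        ∑' m : Site (d + 1), ∑' m' : Site (d + 1), G b.2 (translate T (b.1 : Site (d + 1)) m) b'.2 (translate T (b'.1 : Site (d + 1)) m'))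
      = ∑' u : Site (d + 1), ∑ κ : Fin (d + 1),
          (∑' u' : Site (d + 1), ∑ κ' : Fin (d + 1), G κ u κ' u' * h' (wrapPt T u', κ')) * h (wrapPt T u, κ) := by
  classical
  -- the inner engine at a fixed first bond `(κ, v)`
  have hin : ∀ (κ : Fin (d + 1)) (v : Site (d + 1)),
      ∑ b' : ↥(pbox T) × Fin (d + 1), h' b' * ∑' m' : Site (d + 1), G κ v b'.2 (translate T (b'.1 : Site (d + 1)) m')
        = ∑' u' : Site (d + 1), ∑ κ' : Fin (d + 1), G κ v κ' u' * h' (wrapPt T u', κ') := fun κ v =>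
    sum_mul_tsum_translate_eq_tsum_lift T (fun κ' u' => G κ v κ' u') S (fun κ' u' hu' => hG' κ v κ' u' hu') h'
  -- the outer engine on `F κ v := Σ'_{u′} Σ_{κ′} G κ v κ′ u′ · h′ (…)`
  have hF0 : ∀ (κ : Fin (d + 1)), ∀ v ∉ S, (∑' u' : Site (d + 1), ∑ κ' : Fin (d + 1), G κ v κ' u' * h' (wrapPt T u', κ')) = 0 :=
    fun κ v hv => by simp only [hG κ _ _ v hv, zero_mul, Finset.sum_const_zero, tsum_zero]
  rw [← sum_mul_tsum_translate_eq_tsum_lift T (fun κ v => ∑' u' : Site (d + 1), ∑ κ' : Fin (d + 1), G κ v κ' u' * h' (wrapPt T u', κ')) S hF0 h]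
  refine Finset.sum_congr rfl fun b _ => ?_
  rw [← Finset.mul_sum]
  refine congrArg (fun t : ℝ => h b * t) ?_
  -- `Σ_{b′} h′ b′ · Σ'_m Σ'_{m′} (…) = Σ'_m Σ_{b′} h′ b′ · Σ'_{m′} (…)`: every `b′`-summand is finitely supported in `m`
  have hsum : ∀ b' : ↥(pbox T) × Fin (d + 1), Summable fun m : Site (d + 1) =>
      h' b' * ∑' m' : Site (d + 1), G b.2 (translate T (b.1 : Site (d + 1)) m) b'.2 (translate T (b'.1 : Site (d + 1)) m') := fun b' => by
    obtain ⟨Fm, hFm⟩ := exists_finset_translate T S (b.1 : Site (d + 1))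
    exact summable_of_ne_finset_zero (s := Fm) fun m hm => by
      simp only [hG _ _ _ _ (hFm m hm), tsum_zero, mul_zero]
  calc ∑ b' : ↥(pbox T) × Fin (d + 1), h' b' * ∑' m : Site (d + 1), ∑' m' : Site (d + 1),
          G b.2 (translate T (b.1 : Site (d + 1)) m) b'.2 (translate T (b'.1 : Site (d + 1)) m')
      = ∑ b' : ↥(pbox T) × Fin (d + 1), ∑' m : Site (d + 1), h' b' * ∑' m' : Site (d + 1),
          G b.2 (translate T (b.1 : Site (d + 1)) m) b'.2 (translate T (b'.1 : Site (d + 1)) m') :=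
        Finset.sum_congr rfl fun b' _ => tsum_mul_left.symm
    _ = ∑' m : Site (d + 1), ∑ b' : ↥(pbox T) × Fin (d + 1), h' b' * ∑' m' : Site (d + 1),
          G b.2 (translate T (b.1 : Site (d + 1)) m) b'.2 (translate T (b'.1 : Site (d + 1)) m') :=
        (Summable.tsum_finsetSum fun b' _ => hsum b').symm
    _ = ∑' m : Site (d + 1), ∑' u' : Site (d + 1), ∑ κ' : Fin (d + 1), G b.2 (translate T (b.1 : Site (d + 1)) m) κ' u' * h' (wrapPt T u', κ') :=
        tsum_congr fun m => hin b.2 _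

/-! ## §3 The kernel-level junction at order 2: all pairs of copies load -/

/-- [folklore] **`sum_sum_mul_tsum₂_eq_compIns₂₂_apply` — THE KERNEL-LEVEL (S3-2) FORM OF THE ORDER-2 COMPOSITE JUNCTION, EXACT AT EVERY BOX.**  Letters:
`h0₁ hsucc₁ h0₂ hsucc₂` — OUR chain rules (R-8); `hS ∕ hT ∕ hT′` — windows in the fluctuation slot and in the two family bonds for a fixed multiplier site;
`h𝒲` — the border entries of `𝒲` at the coarse multiplier sites are a kernel of `𝓘₂ lev rs n` (nesting of `hsucc₂`: first bond outer, second bond inner).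
Conclusion, for all torus weights `h, h′` and all slots (`T = towerTorus Lc M n`):
`Σ_{b,b′} h b · h′ b′ · Σ'_{m₁} Σ'_{m₂} Σ'_m 𝒲 b.2 (b.1 + T∘m₁) b′.2 (b′.1 + T∘m₂) (Lc^n • x̄) (z + T∘m) (inr κ₀) (inl β) = compIns₂₂ Lc M lev rs n h h′ (x̄, κ₀) (z, β)`. -/
theorem sum_sum_mul_tsum₂_eq_compIns₂₂_apply
    (𝓘₁ : (ℕ → ℕ) → (ℕ → (Fin (d + 1) → ℕ)) → ℕ → Form1 (d + 1) ℝ → Form1 (d + 1) ℝ → Form1 (d + 1) ℝ)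
    (h0₁ : ∀ (lev : ℕ → ℕ) (rs : ℕ → (Fin (d + 1) → ℕ)) (H B : Form1 (d + 1) ℝ), 𝓘₁ lev rs 0 H B = 0)
    (hsucc₁ : ∀ (lev : ℕ → ℕ) (rs : ℕ → (Fin (d + 1) → ℕ)) (n : ℕ) (H B : Form1 (d + 1) ℝ) (κ : Fin (d + 1)) (x : Site (d + 1)),
      𝓘₁ lev rs (n + 1) H B κ x
        = (((Lc : ℝ) ^ (d + 1) * stepScale d Lc (lev 1)) * (∏ i ∈ Finset.range n, (stepScale d Lc (lev (i + 1 + 1)) * ((box (d + 1) Lc).card : ℝ)))⁻¹) *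
            (∑' u : Site (d + 1), ∑ κ' : Fin (d + 1),
              (∑' z : Site (d + 1), ∑ l : Fin (d + 1), vhKerAt (toSite (rs 1)) Lc κ x (l, z) (κ', u) *
                ((∏ i ∈ Finset.range n, stepScale d Lc (lev (i + 1 + 1))) * compLinAvgAt (fun i => rs (n - i + 1)) Lc n B l z)) *
              ((∏ i ∈ Finset.range n, stepScale d Lc (lev (i + 1 + 1))) * compLinAvgAt (fun i => rs (n - i + 1)) Lc n H κ' u))
          + stepScale d Lc (lev 1) * linAvgAt (toSite (rs 1)) (𝓘₁ (fun k => lev (k + 1)) (fun k => rs (k + 1)) n H B) Lc κ x)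
    (𝓘₂ : (ℕ → ℕ) → (ℕ → (Fin (d + 1) → ℕ)) → ℕ → Form1 (d + 1) ℝ → Form1 (d + 1) ℝ → Form1 (d + 1) ℝ → Form1 (d + 1) ℝ)
    (h0₂ : ∀ (lev : ℕ → ℕ) (rs : ℕ → (Fin (d + 1) → ℕ)) (H H' B : Form1 (d + 1) ℝ), 𝓘₂ lev rs 0 H H' B = 0)
    (hsucc₂ : ∀ (lev : ℕ → ℕ) (rs : ℕ → (Fin (d + 1) → ℕ)) (n : ℕ) (H H' B : Form1 (d + 1) ℝ) (κ₀ : Fin (d + 1)) (x : Site (d + 1)),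
      𝓘₂ lev rs (n + 1) H H' B κ₀ x
        = ((((Lc : ℝ) ^ (d + 1) * stepScale d Lc (lev 1)) * (∏ i ∈ Finset.range n, (stepScale d Lc (lev (i + 1 + 1)) * ((box (d + 1) Lc).card : ℝ)))⁻¹) * (∏ i ∈ Finset.range n, (stepScale d Lc (lev (i + 1 + 1)) * ((box (d + 1) Lc).card : ℝ)))⁻¹) *
            (∑' u : Site (d + 1), ∑ κ : Fin (d + 1), (∑' u' : Site (d + 1), ∑ κ' : Fin (d + 1),
              (∑' z : Site (d + 1), ∑ l : Fin (d + 1),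
                (1 / 2 : ℝ) * (vh2KerAt (toSite (rs 1)) Lc κ₀ x (l, z) (κ, u) (κ', u') + vh2KerAt (toSite (rs 1)) Lc κ₀ x (l, z) (κ', u') (κ, u)) *
                  ((∏ i ∈ Finset.range n, stepScale d Lc (lev (i + 1 + 1))) * compLinAvgAt (fun i => rs (n - i + 1)) Lc n B l z)) *
              ((∏ i ∈ Finset.range n, stepScale d Lc (lev (i + 1 + 1))) * compLinAvgAt (fun i => rs (n - i + 1)) Lc n H' κ' u')) *
              ((∏ i ∈ Finset.range n, stepScale d Lc (lev (i + 1 + 1))) * compLinAvgAt (fun i => rs (n - i + 1)) Lc n H κ u))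
          + (((Lc : ℝ) ^ (d + 1) * stepScale d Lc (lev 1)) * (∏ i ∈ Finset.range n, (stepScale d Lc (lev (i + 1 + 1)) * ((box (d + 1) Lc).card : ℝ)))⁻¹) *
            ((∑' u : Site (d + 1), ∑ κ' : Fin (d + 1),
              (∑' z : Site (d + 1), ∑ l : Fin (d + 1), vhKerAt (toSite (rs 1)) Lc κ₀ x (l, z) (κ', u) * 𝓘₁ (fun k => lev (k + 1)) (fun k => rs (k + 1)) n H' B l z) *
                ((∏ i ∈ Finset.range n, stepScale d Lc (lev (i + 1 + 1))) * compLinAvgAt (fun i => rs (n - i + 1)) Lc n H κ' u))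
            + (∑' u : Site (d + 1), ∑ κ' : Fin (d + 1),
              (∑' z : Site (d + 1), ∑ l : Fin (d + 1), vhKerAt (toSite (rs 1)) Lc κ₀ x (l, z) (κ', u) * 𝓘₁ (fun k => lev (k + 1)) (fun k => rs (k + 1)) n H B l z) *
                ((∏ i ∈ Finset.range n, stepScale d Lc (lev (i + 1 + 1))) * compLinAvgAt (fun i => rs (n - i + 1)) Lc n H' κ' u)))
          + stepScale d Lc (lev 1) * linAvgAt (toSite (rs 1)) (𝓘₂ (fun k => lev (k + 1)) (fun k => rs (k + 1)) n H H' B) Lc κ₀ x)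
    (n : ℕ) (M : Fin (d + 1) → ℕ) [∀ μ, NeZero (M μ)] (lev : ℕ → ℕ) (rs : ℕ → (Fin (d + 1) → ℕ)) (hrs : ∀ k, rs k ∈ box (d + 1) Lc)
    (𝒲 : Fin (d + 1) → Site (d + 1) → Fin (d + 1) → Site (d + 1) → MKer (d + 1) (Fib d)) (W : Site (d + 1) → Finset (Site (d + 1)))
    (hS : ∀ (κ : Fin (d + 1)) (u : Site (d + 1)) (κ' : Fin (d + 1)) (u' x : Site (d + 1)) (μ α : Fin (d + 1)), ∀ z ∉ W x,
      𝒲 κ u κ' u' x z (Sum.inr μ) (Sum.inl α) = 0)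
    (hT : ∀ (κ κ' : Fin (d + 1)) (u' x z : Site (d + 1)) (μ α : Fin (d + 1)), ∀ u ∉ W x, 𝒲 κ u κ' u' x z (Sum.inr μ) (Sum.inl α) = 0)
    (hT' : ∀ (κ : Fin (d + 1)) (u : Site (d + 1)) (κ' : Fin (d + 1)) (x z : Site (d + 1)) (μ α : Fin (d + 1)), ∀ u' ∉ W x,
      𝒲 κ u κ' u' x z (Sum.inr μ) (Sum.inl α) = 0)
    (h𝒲 : ∀ (H H' B : Form1 (d + 1) ℝ) (κ₀ : Fin (d + 1)) (x : Site (d + 1)),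
      (∑' u : Site (d + 1), ∑ κ : Fin (d + 1), (∑' u' : Site (d + 1), ∑ κ' : Fin (d + 1),
        (∑' z : Site (d + 1), ∑ l : Fin (d + 1), 𝒲 κ u κ' u' ((((Lc ^ n : ℕ) : ℤ)) • x) z (Sum.inr κ₀) (Sum.inl l) * B l z) * H' κ' u') * H κ u)
        = 𝓘₂ lev rs n H H' B κ₀ x)
    (h h' : ↥(pbox (towerTorus Lc M n)) × Fin (d + 1) → ℝ) (x : ↥(pbox M)) (κ₀ : Fin (d + 1)) (z : ↥(pbox (towerTorus Lc M n))) (β : Fin (d + 1)) :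
    ∑ b : ↥(pbox (towerTorus Lc M n)) × Fin (d + 1), ∑ b' : ↥(pbox (towerTorus Lc M n)) × Fin (d + 1), h b * (h' b' *
        ∑' m₁ : Site (d + 1), ∑' m₂ : Site (d + 1), ∑' m : Site (d + 1),
          𝒲 b.2 (translate (towerTorus Lc M n) (b.1 : Site (d + 1)) m₁) b'.2 (translate (towerTorus Lc M n) (b'.1 : Site (d + 1)) m₂)
            ((((Lc ^ n : ℕ) : ℤ)) • (x : Site (d + 1))) (translate (towerTorus Lc M n) (z : Site (d + 1)) m) (Sum.inr κ₀) (Sum.inl β))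
      = compIns₂₂ Lc M lev rs n h h' (x, κ₀) (z, β) := by
  classical
  -- the copy sum in the fluctuation site is `𝒲` against the periodic indicator of the torus bond `(z, β)` (R-9 §1)
  have hind : ∀ (κ : Fin (d + 1)) (v : Site (d + 1)) (κ' : Fin (d + 1)) (v' : Site (d + 1)),
      (∑' m : Site (d + 1), 𝒲 κ v κ' v' ((((Lc ^ n : ℕ) : ℤ)) • (x : Site (d + 1))) (translate (towerTorus Lc M n) (z : Site (d + 1)) m) (Sum.inr κ₀) (Sum.inl β))
        = ∑' z' : Site (d + 1), ∑ l : Fin (d + 1), 𝒲 κ v κ' v' ((((Lc ^ n : ℕ) : ℤ)) • (x : Site (d + 1))) z' (Sum.inr κ₀) (Sum.inl l) *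
            (fun l w => KKTFluctuationKernel.delta1 β (z : Site (d + 1)) l (wrap (towerTorus Lc M n) w)) l z' := fun κ v κ' v' => by
    have hsingle : ∀ z' : Site (d + 1), ∑ l : Fin (d + 1), 𝒲 κ v κ' v' ((((Lc ^ n : ℕ) : ℤ)) • (x : Site (d + 1))) z' (Sum.inr κ₀) (Sum.inl l) *
        (fun l w => KKTFluctuationKernel.delta1 β (z : Site (d + 1)) l (wrap (towerTorus Lc M n) w)) l z'
          = 𝒲 κ v κ' v' ((((Lc ^ n : ℕ) : ℤ)) • (x : Site (d + 1))) z' (Sum.inr κ₀) (Sum.inl β) *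
              (if wrap (towerTorus Lc M n) z' = (z : Site (d + 1)) then (1 : ℝ) else 0) := fun z' => by
      have hl : ∀ l : Fin (d + 1), 𝒲 κ v κ' v' ((((Lc ^ n : ℕ) : ℤ)) • (x : Site (d + 1))) z' (Sum.inr κ₀) (Sum.inl l) *
          (fun l w => KKTFluctuationKernel.delta1 β (z : Site (d + 1)) l (wrap (towerTorus Lc M n) w)) l z'
            = if l = β then 𝒲 κ v κ' v' ((((Lc ^ n : ℕ) : ℤ)) • (x : Site (d + 1))) z' (Sum.inr κ₀) (Sum.inl β) *
                (if wrap (towerTorus Lc M n) z' = (z : Site (d + 1)) then (1 : ℝ) else 0) else 0 := fun l => by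
        show _ * KKTFluctuationKernel.delta1 β _ l (wrap _ z') = _
        rw [KKTFluctuationKernel.delta1_apply]
        by_cases hl : l = β
        · subst hl; simp
        · rw [if_neg (fun hc => hl hc.1), if_neg hl, mul_zero]
      rw [Finset.sum_congr rfl fun l _ => hl l, Finset.sum_ite_eq' Finset.univ β]
      simp only [Finset.mem_univ, if_true]
    rw [tsum_congr hsingle]
    exact (tsum_mul_indicator_wrap (towerTorus Lc M n) _ (W ((((Lc ^ n : ℕ) : ℤ)) • (x : Site (d + 1))))
      (fun z' hz' => hS κ v κ' v' _ κ₀ β z' hz') z).symm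
  -- windows of the copy sum in the two family bonds
  have hG₁ : ∀ (κ κ' : Fin (d + 1)) (v' : Site (d + 1)), ∀ v ∉ W ((((Lc ^ n : ℕ) : ℤ)) • (x : Site (d + 1))),
      (∑' m : Site (d + 1), 𝒲 κ v κ' v' ((((Lc ^ n : ℕ) : ℤ)) • (x : Site (d + 1))) (translate (towerTorus Lc M n) (z : Site (d + 1)) m) (Sum.inr κ₀) (Sum.inl β)) = 0 :=
    fun κ κ' v' v hv => (tsum_congr fun m => hT κ κ' v' _ _ κ₀ β v hv).trans tsum_zero
  have hG₂ : ∀ (κ : Fin (d + 1)) (v : Site (d + 1)) (κ' : Fin (d + 1)), ∀ v' ∉ W ((((Lc ^ n : ℕ) : ℤ)) • (x : Site (d + 1))),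
      (∑' m : Site (d + 1), 𝒲 κ v κ' v' ((((Lc ^ n : ℕ) : ℤ)) • (x : Site (d + 1))) (translate (towerTorus Lc M n) (z : Site (d + 1)) m) (Sum.inr κ₀) (Sum.inl β)) = 0 :=
    fun κ v κ' v' hv' => (tsum_congr fun m => hT' κ v κ' _ _ κ₀ β v' hv').trans tsum_zero
  -- assemble: two-variable lift engine ↦ indicator ↦ `h𝒲` ↦ §1
  calc ∑ b : ↥(pbox (towerTorus Lc M n)) × Fin (d + 1), ∑ b' : ↥(pbox (towerTorus Lc M n)) × Fin (d + 1), h b * (h' b' *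
          ∑' m₁ : Site (d + 1), ∑' m₂ : Site (d + 1), ∑' m : Site (d + 1),
            𝒲 b.2 (translate (towerTorus Lc M n) (b.1 : Site (d + 1)) m₁) b'.2 (translate (towerTorus Lc M n) (b'.1 : Site (d + 1)) m₂)
              ((((Lc ^ n : ℕ) : ℤ)) • (x : Site (d + 1))) (translate (towerTorus Lc M n) (z : Site (d + 1)) m) (Sum.inr κ₀) (Sum.inl β))
      = ∑' u : Site (d + 1), ∑ κ : Fin (d + 1), (∑' u' : Site (d + 1), ∑ κ' : Fin (d + 1),
          (∑' m : Site (d + 1), 𝒲 κ u κ' u' ((((Lc ^ n : ℕ) : ℤ)) • (x : Site (d + 1)))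
            (translate (towerTorus Lc M n) (z : Site (d + 1)) m) (Sum.inr κ₀) (Sum.inl β)) * h' (wrapPt (towerTorus Lc M n) u', κ')) *
          h (wrapPt (towerTorus Lc M n) u, κ) :=
        sum_sum_mul_tsum_translate₂_eq_tsum_lift₂ (towerTorus Lc M n)
          (fun κ v κ' v' => ∑' m : Site (d + 1), 𝒲 κ v κ' v' ((((Lc ^ n : ℕ) : ℤ)) • (x : Site (d + 1)))
            (translate (towerTorus Lc M n) (z : Site (d + 1)) m) (Sum.inr κ₀) (Sum.inl β)) _ hG₁ hG₂ h h'
    _ = ∑' u : Site (d + 1), ∑ κ : Fin (d + 1), (∑' u' : Site (d + 1), ∑ κ' : Fin (d + 1),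
          (∑' z' : Site (d + 1), ∑ l : Fin (d + 1), 𝒲 κ u κ' u' ((((Lc ^ n : ℕ) : ℤ)) • (x : Site (d + 1))) z' (Sum.inr κ₀) (Sum.inl l) *
            (fun l w => KKTFluctuationKernel.delta1 β (z : Site (d + 1)) l (wrap (towerTorus Lc M n) w)) l z')
            * (fun l w => h' (wrapPt (towerTorus Lc M n) w, l)) κ' u') * (fun l w => h (wrapPt (towerTorus Lc M n) w, l)) κ u :=
        tsum_congr fun u => Finset.sum_congr rfl fun κ _ => by
          refine congrArg (fun t : ℝ => t * _) ?_
          exact tsum_congr fun u' => Finset.sum_congr rfl fun κ' _ => by rw [hind]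
    _ = 𝓘₂ lev rs n (fun l w => h (wrapPt (towerTorus Lc M n) w, l)) (fun l w => h' (wrapPt (towerTorus Lc M n) w, l))
          (fun l w => KKTFluctuationKernel.delta1 β (z : Site (d + 1)) l (wrap (towerTorus Lc M n) w)) κ₀ (x : Site (d + 1)) := h𝒲 _ _ _ κ₀ _
    _ = compIns₂₂ Lc M lev rs n h h' (x, κ₀) (z, β) :=
        (compIns₂₂_apply_eq Lc 𝓘₁ h0₁ hsucc₁ 𝓘₂ h0₂ hsucc₂ n M lev rs hrs h h' x κ₀ z β).symm

end Summit.QuantumFields.BalabanUV.Beta.FP.TorusCompositeInsertionKernelTwo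

end
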